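import Literature.IUT.LogThetaLattice.PacketLogVolumesCapsules
import HarnessLib

/-!
# [IUTchIII] Proposition 3.9 (iii) for capsules — the PACKET-NORMALISED version (weight `1`; correction of the
# normalisation constant of `PacketLogVolumesCapsules.lean`, finding d035-F1) (abc-iut cell, layer L6)

S. Mochizuki, *Inter-universal Teichmüller theory III*, kurims manuscript (May 2020), §3, Proposition 3.9 (i)
p. 115–116 ("we assume that these log-volumes are normalized so that multiplication of an element of `𝕄(−)` by
`p_v` corresponds to adding the quantity `−log(p_v) ∈ ℝ`; we shall refer to this normalization as the
packet-normalization") and (iii) p. 117 [claim: Mochizuki2012, status: disputed]; Remark 3.1.1 (ii)–(iv)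
pp. 94–97 (the WEIGHTED sums defining log-volumes on tensor packets; (iii): "such weighted sums of log-volumes
do not, in general, arise as some positive real multiple of the [natural] logarithm of a volume").

`PacketLogVolumesCapsules.lean` (abc-iut-L6-d3, p410592, FROZEN) modelled `μ^log_{A,v_ℚ}` at the divisor level as
`capsuleWeight · Σ_α packetDivisorLogVolume (c α)` with `capsuleWeight = [F:ℚ]^{|A|-1}`, deriving that constant
from the UNWEIGHTED Haar measure on the `d^{|A|}`-dimensional tensor packet. abc-iut-w4-d035's finding d035-F1
(kernel witness `PacketWeightsCapsuleAdditivity.lean`, p412056: `sum_packetWeightTensor_mul_tensorDetChange`,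
`capsule_packetNormalized`, `capsule_unweighted_not_normalized`, over abc-iut-L6-t4's `packetWeightTensor`) shows
that the printed packet-normalisation uses the Rmk. 3.1.1 weights, which CANCEL that exponent: the printed
`μ^log_{A,v_ℚ}` of `⊗_α 𝔞_α` is `Σ_α μ^log_{α,v_ℚ}(𝔞_α)` — ADDITIVE over the labels, in the SAME unit for every
`A`. This file supplies that version, in the unit of `PacketLogVolumesPrincipalPackets.lean` (`|A| = 1`), and
re-proves the three clauses of Prop. 3.9 (iii) for it; the "suitable normalization" of the degree clause is
then ONE constant for all `A` (`c = 1`, as in `prop39iii_degree_packetModel`). The typed Props of the frozen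
file remain true (they allow any constant); `capsuleLogVolume_eq_capsuleWeight_mul` relates the two versions.
Nothing here constructs a tensor packet or a Frobenioid, asserts anything about Cor. 3.12, or takes a side.
-/

noncomputable section

namespace Literature.IUT.LogThetaLattice

open Literature.IUT.LogVolume NumberField

universe u

variable (F : Type u) [Field F] [NumberField F] (A : Type) [Fintype A]

/-! ### Correction (finding d035-F1): the PACKET-NORMALISED capsule log-volume has weight `1`

The constant `capsuleWeight F A = [F:ℚ]^{|A|-1}` of the section above is the exponent produced by the
UNWEIGHTED Haar measure on the `d^{|A|}`-dimensional tensor packet (the [MODELLING] computation of the module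
docstring). The printed `μ^log_{A,v_ℚ}` is NOT a multiple of the logarithm of a Haar measure on the packet
([IUTchIII] Rmk. 3.1.1 (iii), p. 95: "such weighted sums of log-volumes do not, in general, arise as some
positive real multiple of the logarithm of a volume"): it is the WEIGHTED sum of Rmk. 3.1.1 (ii)/(iv)
(abc-iut-L6-t4's `packetWeightTensor`), packet-normalised so that multiplication by `p_{v_ℚ}` adds `−log p_{v_ℚ}`
for EVERY `A` (Prop. 3.9 (i), p. 115), and those weights cancel the determinant exponent exactly — kernel
witness by abc-iut-w4-d035, `Literature/IUT/LogThetaLattice/PacketWeightsCapsuleAdditivity.lean` (p412056: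
`sum_packetWeightTensor_mul_tensorDetChange`, `capsule_packetNormalized`, `capsule_unweighted_not_normalized`).
Consequently, in the unit of `PacketLogVolumesPrincipalPackets.lean` (`|A| = 1`; `= [F:ℚ] ×` print's
packet-normalised unit, uniformly in `A`) the faithful `A`-capsule log-volume is ADDITIVE over the labels with
weight `1`, and the "suitable normalization" of Prop. 3.9 (iii) is ONE constant for all `A` — here `c = 1`, the
constant of `prop39iii_degree_packetModel`. This section supplies that version (`…₁`); the weighted version
above stays as the unweighted-Haar bookkeeping, related by `capsuleLogVolume_eq_capsuleWeight_mul`.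
[claim: Mochizuki2012, status: disputed] for the quoted sentences. -/

section PacketNormalised

/-- **The packet-normalised `A`-capsule log-volume** `μ^log_{A,v_ℚ}` at the divisor level, in the `|A| = 1` unit:
`Σ_{α ∈ A} Σ_{v | v_ℚ} c_{α,v}·w_v` — additive over the labels, weight `1` (finding d035-F1; Prop. 3.9 (i)
packet-normalisation). [claim: Mochizuki2012, status: disputed] -/
def capsuleLogVolume₁ (q : RatPlace) (c : A → Packet F q → ℝ) : ℝ :=
  ∑ α, packetDivisorLogVolume F q (c α)

/-- Bridge: the unweighted-Haar version is `[F:ℚ]^{|A|-1}` times the packet-normalised one.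
[claim: Mochizuki2012, status: disputed] -/
theorem capsuleLogVolume_eq_capsuleWeight_mul (q : RatPlace) (c : A → Packet F q → ℝ) :
    capsuleLogVolume F A q c = capsuleWeight F A * capsuleLogVolume₁ F A q c := rfl

/-- `|A| = 1`: the packet-normalised capsule log-volume IS the single-label packet log-volume.
[claim: Mochizuki2012, status: disputed] -/
theorem capsuleLogVolume₁_unique [Unique A] (q : RatPlace) (c : A → Packet F q → ℝ) :
    capsuleLogVolume₁ F A q c = packetDivisorLogVolume F q (c default) := by
  simp [capsuleLogVolume₁]

/-- "invariant … with respect to permutations of `A`", locally, packet-normalised version.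
[claim: Mochizuki2012, status: disputed] -/
theorem capsuleLogVolume₁_perm (q : RatPlace) (c : A → Packet F q → ℝ) (σ : Equiv.Perm A) :
    capsuleLogVolume₁ F A q (fun α => c (σ α)) = capsuleLogVolume₁ F A q c := by
  unfold capsuleLogVolume₁
  rw [Equiv.sum_comp σ (fun α => packetDivisorLogVolume F q (c α))]

/-- The packet-normalised capsule log-volume vanishes when every label's packet log-volume does.
[claim: Mochizuki2012, status: disputed] -/
theorem capsuleLogVolume₁_eq_zero {q : RatPlace} {c : A → Packet F q → ℝ}
    (h : ∀ α, packetDivisorLogVolume F q (c α) = 0) : capsuleLogVolume₁ F A q c = 0 := by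
  simp [capsuleLogVolume₁, h]

/-- The region `S_𝔞 = ⊗_α ∏_v 𝔭_v^{-𝔞_α(v)}` as a global region for the packet-normalised capsule log-volume.
[claim: Mochizuki2012, status: disputed] -/
def capsuleRegionOf₁ (a : A → ADivisor F) : GlobalRegion (capsuleLogVolume₁ F A) :=
  ⟨fun q α v => a α v.1, by
    refine (Set.finite_iUnion fun α : A => (packetRegionOf F (a α)).2).subset fun q hq => ?_
    rw [Set.mem_iUnion]
    by_contra h
    push Not at h
    apply Function.mem_support.mp hq
    refine capsuleLogVolume₁_eq_zero F A fun α => ?_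
    have hα := h α
    rw [Function.notMem_support] at hα
    exact hα⟩

/-- Coordinates of `S_𝔞` (packet-normalised version). [claim: Mochizuki2012, status: disputed] -/
@[simp] theorem capsuleRegionOf₁_apply (a : A → ADivisor F) (q : RatPlace) (α : A) (v : Packet F q) :
    (capsuleRegionOf₁ F A a).1 q α v = a α v.1 := rfl

/-- **`μ^log_{A,𝕍_ℚ}(S_𝔞) = Σ_α deg_F(𝔞_α)`** (packet-normalised; no `[F:ℚ]^{|A|-1}`).
[claim: Mochizuki2012, status: disputed] -/
theorem globalLogVolume_capsuleRegionOf₁ (a : A → ADivisor F) :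
    globalLogVolume (capsuleLogVolume₁ F A) (capsuleRegionOf₁ F A a) = ∑ α, degF F (a α) := by
  rw [globalLogVolume]
  change ∑ᶠ q, ∑ α, packetDivisorLogVolume F q ((packetRegionOf F (a α)).1 q) = _
  rw [finsum_sum_comm _ _ fun α _ => (packetRegionOf F (a α)).2]
  exact Finset.sum_congr rfl fun α _ => globalLogVolume_packetRegionOf F (a α)

/-- Permutation invariance, globally, packet-normalised version. [claim: Mochizuki2012, status: disputed] -/
theorem globalLogVolume_capsuleRegionOf₁_perm (a : A → ADivisor F) (σ : Equiv.Perm A) :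
    globalLogVolume (capsuleLogVolume₁ F A) (capsuleRegionOf₁ F A (fun α => a (σ α))) =
      globalLogVolume (capsuleLogVolume₁ F A) (capsuleRegionOf₁ F A a) := by
  rw [globalLogVolume_capsuleRegionOf₁, globalLogVolume_capsuleRegionOf₁,
    Equiv.sum_comp σ (fun α => degF F (a α))]

/-- The local correction term under `f ∈ (†𝕄⊛_mod)_α`, packet-normalised: `−Σ_{v|v_ℚ} ADiv(f)_v·w_v`, supported
on finitely many `v_ℚ`. [folklore] -/
private theorem finite_support_capsule_principal₁ (f : F) :
    (Function.support fun q =>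
      -packetDivisorLogVolume F q ((packetRegionOf F (ADivisor.principal f)).1 q)).Finite := by
  refine (packetRegionOf F (ADivisor.principal f)).2.subset fun q hq => ?_
  exact Function.mem_support.mpr (neg_ne_zero.mp (Function.mem_support.mp hq))

/-- The product formula for the packet-normalised correction terms. [folklore] -/
private theorem finsum_capsule_principal₁ (f : F) :
    ∑ᶠ q, -packetDivisorLogVolume F q ((packetRegionOf F (ADivisor.principal f)).1 q) = 0 := by
  rw [finsum_neg_distrib, finsum_packet_principal, neg_zero]

variable [DecidableEq A]

/-- Multiplication by `f ∈ (†𝕄⊛_mod)_α` on regions for the packet-normalised capsule log-volume (the `α`-th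
factor only). [claim: Mochizuki2012, status: disputed] -/
def capsulePrincipalAction₁ (α : A) (f : Fˣ) (S : GlobalRegion (capsuleLogVolume₁ F A)) :
    GlobalRegion (capsuleLogVolume₁ F A) :=
  ⟨fun q β v => S.1 q β v - if β = α then ADivisor.principal (f : F) v.1 else 0, by
    have h1 := S.2
    have h2 := (packetRegionOf F (ADivisor.principal (f : F))).2
    refine (h1.union h2).subset fun q hq => ?_
    by_contra hq'
    rw [Set.mem_union, not_or, Function.notMem_support, Function.notMem_support] at hq'
    apply Function.mem_support.mp hq
    change ∑ β, packetDivisorLogVolume F q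
      (fun v => S.1 q β v - if β = α then ADivisor.principal (f : F) v.1 else 0) = 0
    have hβ : ∀ β, packetDivisorLogVolume F q
        (fun v => S.1 q β v - if β = α then ADivisor.principal (f : F) v.1 else 0) =
        packetDivisorLogVolume F q (S.1 q β) -
          if β = α then packetDivisorLogVolume F q ((packetRegionOf F (ADivisor.principal (f : F))).1 q)
          else 0 := by
      intro β
      rw [packetDivisorLogVolume_sub]
      split_ifs with h
      · rfl
      · rw [packetDivisorLogVolume_eq_zero F fun _ => rfl]
    simp_rw [hβ, Finset.sum_sub_distrib, Finset.sum_ite_eq', Finset.mem_univ, if_true, hq'.2, sub_zero]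
    have h0 : ∑ β, packetDivisorLogVolume F q (S.1 q β) = 0 := hq'.1
    exact h0⟩

/-- Coordinates after multiplication by `f ∈ (†𝕄⊛_mod)_α` (packet-normalised version).
[claim: Mochizuki2012, status: disputed] -/
@[simp] theorem capsulePrincipalAction₁_apply (α : A) (f : Fˣ)
    (S : GlobalRegion (capsuleLogVolume₁ F A)) (q : RatPlace) (β : A) (v : Packet F q) :
    (capsulePrincipalAction₁ F A α f S).1 q β v =
      S.1 q β v - if β = α then ADivisor.principal (f : F) v.1 else 0 := rfl

/-- The local change of the packet-normalised `μ^log_{A,v_ℚ}` under `f ∈ (†𝕄⊛_mod)_α`: `−Σ_{v|v_ℚ} ADiv(f)_v·w_v`.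
[claim: Mochizuki2012, status: disputed] -/
theorem capsuleLogVolume₁_capsulePrincipalAction₁ (α : A) (f : Fˣ)
    (S : GlobalRegion (capsuleLogVolume₁ F A)) (q : RatPlace) :
    capsuleLogVolume₁ F A q ((capsulePrincipalAction₁ F A α f S).1 q) =
      capsuleLogVolume₁ F A q (S.1 q) +
        -packetDivisorLogVolume F q ((packetRegionOf F (ADivisor.principal (f : F))).1 q) := by
  change ∑ β, packetDivisorLogVolume F q
      (fun v => S.1 q β v - if β = α then ADivisor.principal (f : F) v.1 else 0) = _
  have hβ : ∀ β, packetDivisorLogVolume F q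
      (fun v => S.1 q β v - if β = α then ADivisor.principal (f : F) v.1 else 0) =
      packetDivisorLogVolume F q (S.1 q β) -
        if β = α then packetDivisorLogVolume F q ((packetRegionOf F (ADivisor.principal (f : F))).1 q)
        else 0 := by
    intro β
    rw [packetDivisorLogVolume_sub]
    split_ifs with h
    · rfl
    · rw [packetDivisorLogVolume_eq_zero F fun _ => rfl]
  simp_rw [hβ, Finset.sum_sub_distrib, Finset.sum_ite_eq', Finset.mem_univ, if_true]
  unfold capsuleLogVolume₁
  ring

/-- **IUTchIII:Prop3.9(iii) for capsules, packet-normalised — invariance under `(†𝕄⊛_mod)_α` for EVERY label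
`α`** (product formula; finding d035-F1's normalisation). [claim: Mochizuki2012, status: disputed] -/
theorem prop39iii_invariance_capsuleModel₁ (α : A) :
    Prop39iii_invariance (capsuleLogVolume₁ F A) (capsulePrincipalAction₁ F A α) :=
  Prop39iii_invariance_of_productFormula (capsuleLogVolume₁ F A) (capsulePrincipalAction₁ F A α)
    (fun f q => -packetDivisorLogVolume F q ((packetRegionOf F (ADivisor.principal (f : F))).1 q))
    (fun f => finite_support_capsule_principal₁ F (f : F))
    (fun f => finsum_capsule_principal₁ F (f : F))
    (fun f S q => capsuleLogVolume₁_capsulePrincipalAction₁ F A α f S q)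

/-- The region of `𝔍 ∈ (†𝓕⊛_mod)_α` (divisor of `𝔍` in the `α`-th factor, integral structures elsewhere),
packet-normalised version. [claim: Mochizuki2012, status: disputed] -/
def capsuleObjRegionOf₁ (α : A) (a : ADivisor F) : GlobalRegion (capsuleLogVolume₁ F A) :=
  capsuleRegionOf₁ F A (Pi.single α a)

/-- `μ^log_{A,𝕍_ℚ}` of the region of `𝔍 ∈ (†𝓕⊛_mod)_α`, packet-normalised: `deg_F(𝔍)` — no `|A|`-dependence.
[claim: Mochizuki2012, status: disputed] -/
theorem globalLogVolume_capsuleObjRegionOf₁ (α : A) (a : ADivisor F) :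
    globalLogVolume (capsuleLogVolume₁ F A) (capsuleObjRegionOf₁ F A α a) = degF F a := by
  rw [capsuleObjRegionOf₁, globalLogVolume_capsuleRegionOf₁,
    Finset.sum_eq_single α (fun β _ hβ => by rw [Pi.single_eq_of_ne hβ, map_zero])
      (fun h => absurd (Finset.mem_univ α) h), Pi.single_eq_same]

/-- **IUTchIII:Prop3.9(iii) for capsules, packet-normalised — the degree property with the SAME constant for
every `A`** (`c = 1`, as in `prop39iii_degree_packetModel`; Prop. 3.9 (iii)'s "suitable normalization" is one
normalisation for all capsule index sets — finding d035-F1). [claim: Mochizuki2012, status: disputed] -/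
theorem prop39iii_degree_capsuleModel₁ (α : A) :
    Prop39iii_degree (capsuleLogVolume₁ F A) (capsuleObjRegionOf₁ F A α) (degF F) :=
  ⟨1, one_pos, fun a => by rw [one_mul]; exact globalLogVolume_capsuleObjRegionOf₁ F A α a⟩

end PacketNormalised


end Literature.IUT.LogThetaLattice
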